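import Summits.QuantumFields.BalabanUV.Beta.FP.TowerDoorGaugeCopies
import Summits.QuantumFields.BalabanUV.Beta.FP.TowerDoorUniformDataNested
import Summits.QuantumFields.BalabanUV.Beta.FP.TowerDoorUniformDataTorus
import Summits.QuantumFields.BalabanUV.Beta.FP.QstepSymTwoBlock

/-!
# `BalabanUV.Beta.FP.TowerDoorGaugeLatticeSum` — binder row D1, the row's ONE file, LEMMA U ON THE LATTICE (J-NOTE-20 §7∕§9 (3)):
# **THE LATTICE GAUGE FUNCTION SUMMED OVER THE SOURCES VANISHES IDENTICALLY — `Σ'_z λℤ_(μ,z)(u) = 0` for every lattice site `u`** (K2L-LAM's «Λ_μ constant», the constant being `0`,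
# now on `ℤ⁴`), and `λℤ` is jointly `L`-block covariant (`λℤ_(μ, z+t)(u + L•t) = λℤ_(μ,z)(u)`); composed BY NAME from PART 55's reference objects (NO invertibility needed: the source sum of the
# reference columns is the FACE FIELD — PART 51∕52's U1 — which the reference nested slice KILLS — PART 53's U2 at the reference tower, (TB) by road (B) `QSym_twoBlock`), the rest being
# PART 56 §1's `HasSum` bookkeeping through `−(N·W₀)⁻¹·N` and the finite read-out
# (β-function cell `pub-balaban`, BINDER-OWNERS row D1 ∕ (C1) OWNER «beta-an2» gen 77, PART 58; imports PART 56 + PART 53 + PART 52 + road (B))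

WHAT ([folklore] `HasSum` ∕ finite `Matrix` ∕ floor-division bookkeeping BY NAME; no `def`, no `def … : Prop`, nothing cited, 0 sorry, default heartbeats).
§1 (generic `d`, kernel-generic, ANY root list, NO `det` hypothesis): `lamZ_translate` (joint block covariance, from road (C1) `quo_add_zsmul`); **`hasSum_lamZ_sources`**: if the kernel's sublattice
field–multiplier columns are summable (`hAs`) and their source sums vanish on every bond whose endpoints share their `L`-block (`hface` — the face-field property), then
`HasSum (z ↦ lamZ Lc lev rs hrs n A μ z u) 0` (re-index `z ↦ z − quo L u`; `HasSum refCol X∞` coordinatewise; `refSlice *ᵥ X∞ = 0` by PART 53 `nestedRows_mulVec_eq_zero_of_faceSupported` at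
`M := fun _ => Lc`, `Q := QSym Lc`, (TB) := road (B) `QSym_twoBlock`; `HasSum refTheta (−(N·W₀)⁻¹·0) = 0` by PART 56 `hasSum_mulVec`; the read-out by PART 56 `hasSum_readout`).
§2 (`d = 3`) at the record's chart `scaleK σ σ (AN R (n+1))`: `hAs` = PART 52 `summable_scaleK_AN_inl_inr_sources`, `hface` = PART 52 `tsum_scaleK_AN_inl_inr_sources_eq` + PART 53 `faceField_faceSupported`:
**`hasSum_lamZ_sources_record` ∕ `tsum_lamZ_sources_record` — `Σ'_z lamZ Lc lev rs hrs n (scaleK σ σ (AN R (n+1))) μ z u = 0` for EVERY `u`, every root list, unconditionally.**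
WHAT THIS IS NOT: not v10's `hΘ` letter itself (it reads the door's `τd ∕ lamd ∕ DefKerℤ`, still to be defined — the exchange `Σ_z τd(λℤ_z) = τd(Σ_z λℤ_z)` is PART 40∕43-class bookkeeping for the next file);
the door NOT defined; nothing of Bałaban's asserted, valued or discharged; 0 estimates; 0∕4 row-D1 binders (hW, hR, D1Tel, D1Rep); v10 NOT filed; v9 p617999 stands; NOT (C1), NOT (T-ID), NOT D1,
NEVER «G-an2-4 closed», NOT BetaPertH, NOT continuum, NOT Clay.

HONEST DEPENDENCY (page 1, mandatory): continuum YM on T⁴ ⇐ BetaPertH ∧ nine spine estimates (0/9 proved); BetaPertH ⇐ (D1) ∧ (D4) ∧ CAP+tail;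
G-an2-4 gates asym, D1 and NE2/3/4.  HONEST FRAMING (cell contract, verbatim): «discharging `BetaPertH` makes Bałaban's UV stability UNCONDITIONAL —
a real constructive-QFT result; it is NOT the continuum limit and NOT the Clay problem.»  ABSOLUTE RULE (cell charter, verbatim): «No internally-minted
statement may enter as a cited fact. Every hypothesis is either kernel-proved in this package or a verbatim quotation of a PUBLISHED theorem with page
reference. The manuscript(s) under audit are NOT citable for their own disputed steps — they are the thing under adjudication; programme-internal
(2001/route/tribunal) claims are never citable.»  Row D1 ∕ (C1) OWNER «beta-an2» gen 77, 2026-08-29.  No existing file touched.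
-/

noncomputable section

open Finset Matrix
open scoped BigOperators
open Literature.MathematicalPhysics.QuantumFieldTheory
open Literature.MathematicalPhysics.QuantumFieldTheory.Balaban1983to89
open Literature.MathematicalPhysics.QuantumFieldTheory.Balaban1983to89.Beta
open B5Prop11Plancherel (fine)
open B6Lemma24Torus (pbox)
open AffineAveraging (Site box toSite unitVec)
open AveragingContoursRooted (ctrOff ctrOff_mem_box)
open OneStepResolventKernel (Fib)
open ExpKernelCalculus (MKer)
open HessKerRate (scaleK)
open Literature.MathematicalPhysics.QuantumFieldTheory.LatticeForm (quo)
open Summit.QuantumFields.BalabanUV.Beta.CompositeOneShotJetData (Roots AN)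
open Summit.QuantumFields.BalabanUV.Beta.FP.TorusCombRows (Res)
open Summit.QuantumFields.BalabanUV.Beta.FP.TorusCompositeObjects (towerTorus NParam combF bigP towerGen bigRoot bigRatio bigRatio_eq_pow bigRatio_pos towerEquiv)
open Summit.QuantumFields.BalabanUV.Beta.FP.TorusCompositeObjectsG (QSym compRowsSym)
open Summit.QuantumFields.BalabanUV.Beta.FP.TorusCompositeUnimodular (towerEvalC)
open Summit.QuantumFields.BalabanUV.Beta.FP.TorusCombTranslate (quo_add_zsmul)
open Summit.QuantumFields.BalabanUV.Beta.FP.TorusReferenceBlock (sub_zsmul_quo_mem_pbox_ref)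
open Summit.QuantumFields.BalabanUV.Beta.FP.QstepSymTwoBlock (QSym_twoBlock)
open Summit.QuantumFields.BalabanUV.Beta.FP.TowerDoorUniformDataTorus (summable_scaleK_AN_inl_inr_sources tsum_scaleK_AN_inl_inr_sources_eq)
open Summit.QuantumFields.BalabanUV.Beta.FP.TowerDoorUniformDataNested (nestedRows_mulVec_eq_zero_of_faceSupported faceField_faceSupported)
open Summit.QuantumFields.BalabanUV.Beta.FP.TowerDoorGaugeRefDefs
open Summit.QuantumFields.BalabanUV.Beta.FP.TowerDoorGaugeCopies (hasSum_mulVec hasSum_readout)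

namespace Summit.QuantumFields.BalabanUV.Beta.FP.TowerDoorGaugeLatticeSum

variable {d : ℕ}

/-! ## §1 Kernel-generic: joint block covariance; the source sum of `λℤ` vanishes -/

section Generic

variable (Lc : ℕ) [NeZero Lc] (lev : ℕ → ℕ) (rs : ℕ → (Fin (d + 1) → ℕ))
  (hrs : ∀ k i, 0 ≤ toSite (rs k) i ∧ toSite (rs k) i < (Lc : ℤ)) (n : ℕ) (A : MKer (d + 1) (Fib d))

/-- [folklore] **`lamZ_translate` — JOINT `L`-BLOCK COVARIANCE OF THE LATTICE GAUGE FUNCTION**: `lamZ … μ (z + t) (u + L•t) = lamZ … μ z u` (the representative of `u + L•t` is that of `u`, the source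
moves with the block: road (C1) `quo_add_zsmul`). -/
theorem lamZ_translate (μ : Fin (d + 1)) (z u t : Site (d + 1)) :
    lamZ Lc lev rs hrs n A μ (z + t) (u + ((bigRatio Lc (n + 1) : ℕ) : ℤ) • t) = lamZ Lc lev rs hrs n A μ z u := by
  have hL : 0 < bigRatio Lc (n + 1) := bigRatio_pos Lc (Nat.pos_of_ne_zero (NeZero.ne Lc)) (n + 1)
  have hq : quo (bigRatio Lc (n + 1)) (u + ((bigRatio Lc (n + 1) : ℕ) : ℤ) • t) = quo (bigRatio Lc (n + 1)) u + t := quo_add_zsmul hL u t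
  have hrep : (⟨u + ((bigRatio Lc (n + 1) : ℕ) : ℤ) • t + ((bigRatio Lc (n + 1) : ℕ) : ℤ) • (-quo (bigRatio Lc (n + 1)) (u + ((bigRatio Lc (n + 1) : ℕ) : ℤ) • t)),
        sub_zsmul_quo_mem_pbox_ref Lc n (u + ((bigRatio Lc (n + 1) : ℕ) : ℤ) • t)⟩ : ↥(pbox (towerTorus Lc (fun _ : Fin (d + 1) => Lc) (n + 1))))
      = ⟨u + ((bigRatio Lc (n + 1) : ℕ) : ℤ) • (-quo (bigRatio Lc (n + 1)) u), sub_zsmul_quo_mem_pbox_ref Lc n u⟩ := by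
    apply Subtype.ext
    simp only [hq, neg_add, smul_add, smul_neg]
    abel
  rw [lamZ_eq, lamZ_eq, hrep, hq, show z + t - (quo (bigRatio Lc (n + 1)) u + t) = z - quo (bigRatio Lc (n + 1)) u by abel]

/-- [folklore] **`hasSum_lamZ_sources` — LEMMA U ON THE LATTICE, KERNEL-GENERIC, NO INVERTIBILITY**: if the sublattice field–multiplier columns `z ↦ A x (L•z) (inl κ) (inr μ)` are summable and their
source sums VANISH on every bond whose two endpoints share their `L`-block (the face-field property of U1), then `HasSum (z ↦ lamZ Lc lev rs hrs n A μ z u) 0` for every lattice site `u`: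
the source sum of the reference columns is face-supported, the reference nested slice kills it (PART 53 U2 at `fun _ => Lc` over road (B)'s (TB)), and `−(N·W₀)⁻¹·N`, `towerEvalC`, the read-out are
finite linear maps (PART 56 §1). -/
theorem hasSum_lamZ_sources (μ : Fin (d + 1))
    (hAs : ∀ (x : Site (d + 1)) (κ : Fin (d + 1)), Summable (fun z : Site (d + 1) => A x (((bigRatio Lc (n + 1) : ℕ) : ℤ) • z) (Sum.inl κ) (Sum.inr μ)))
    (hface : ∀ (x : Site (d + 1)) (κ : Fin (d + 1)), quo (bigRatio Lc (n + 1)) x = quo (bigRatio Lc (n + 1)) (x + unitVec κ) →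
      (∑' z : Site (d + 1), A x (((bigRatio Lc (n + 1) : ℕ) : ℤ) • z) (Sum.inl κ) (Sum.inr μ)) = 0)
    (u : Site (d + 1)) :
    HasSum (fun z : Site (d + 1) => lamZ Lc lev rs hrs n A μ z u) 0 := by
  set q : Site (d + 1) := quo (bigRatio Lc (n + 1)) u with hq
  -- the source sum of the reference columns, coordinatewise
  set X : ↥(pbox (towerTorus Lc (fun _ : Fin (d + 1) => Lc) (n + 1))) × Fin (d + 1) → ℝ := fun b =>
    ∑' z : Site (d + 1), A (b.1 : Site (d + 1)) (((bigRatio Lc (n + 1) : ℕ) : ℤ) • z) (Sum.inl b.2) (Sum.inr μ) with hX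
  have hcol : HasSum (fun z : Site (d + 1) => refCol Lc n A μ z) X := by
    rw [Pi.hasSum]
    intro b
    exact (hAs (b.1 : Site (d + 1)) b.2).hasSum
  -- the reference nested slice kills it (U2 at the reference tower)
  have hNX : refSlice Lc lev rs hrs n *ᵥ X = 0 :=
    nestedRows_mulVec_eq_zero_of_faceSupported Lc (QSym Lc) (QSym_twoBlock Lc) (fun _ : Fin (d + 1) => Lc) lev rs hrs (fun _ => dvd_rfl) n
      rfl rfl rfl (refSlice_eq Lc lev rs hrs n) (fun b hb => hface (b.1 : Site (d + 1)) b.2 hb)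
  -- hence the gauge parameters sum to `0`, and so do their read-outs
  have hθ : HasSum (fun z : Site (d + 1) => refTheta Lc lev rs hrs n A μ z) 0 := by
    have h := (hasSum_mulVec (refSlice Lc lev rs hrs n * towerGen Lc (fun _ : Fin (d + 1) => Lc) rs (n + 1))⁻¹
      (hasSum_mulVec (refSlice Lc lev rs hrs n) hcol)).neg
    rw [hNX, Matrix.mulVec_zero, neg_zero] at h
    exact h
  have hr := hasSum_readout (towerEvalC Lc (fun _ : Fin (d + 1) => Lc) rs hrs (n + 1))
    (fun x : Res (bigRoot Lc rs (n + 1)) (bigRatio Lc (n + 1)) (towerTorus Lc (fun _ : Fin (d + 1) => Lc) (n + 1)) =>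
      (x.1 : ↥(pbox (towerTorus Lc (fun _ : Fin (d + 1) => Lc) (n + 1)))))
    (towerEquiv Lc (fun _ : Fin (d + 1) => Lc) rs hrs (n + 1))
    (⟨u + ((bigRatio Lc (n + 1) : ℕ) : ℤ) • (-q), sub_zsmul_quo_mem_pbox_ref Lc n u⟩ : ↥(pbox (towerTorus Lc (fun _ : Fin (d + 1) => Lc) (n + 1)))) hθ
  rw [Matrix.mulVec_zero] at hr
  simp only [Pi.zero_apply, ite_self, Finset.sum_const_zero] at hr
  -- re-index the sources by the block of `u`
  have e : (fun z : Site (d + 1) => lamZ Lc lev rs hrs n A μ z u)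
      = (fun z : Site (d + 1) => -(∑ x : Res (bigRoot Lc rs (n + 1)) (bigRatio Lc (n + 1)) (towerTorus Lc (fun _ : Fin (d + 1) => Lc) (n + 1)),
          (if (x.1 : ↥(pbox (towerTorus Lc (fun _ : Fin (d + 1) => Lc) (n + 1)))) = ⟨u + ((bigRatio Lc (n + 1) : ℕ) : ℤ) • (-q), sub_zsmul_quo_mem_pbox_ref Lc n u⟩
            then (towerEvalC Lc (fun _ : Fin (d + 1) => Lc) rs hrs (n + 1) *ᵥ refTheta Lc lev rs hrs n A μ z) (towerEquiv Lc (fun _ : Fin (d + 1) => Lc) rs hrs (n + 1) x) else 0)))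
        ∘ (Equiv.subRight q) := by
    funext z
    simp only [Function.comp_apply, Equiv.subRight_apply, lamZ_eq, hq]
  rw [e, (Equiv.subRight q).hasSum_iff]
  simpa using hr.neg

/-- [folklore] … hence `Σ'_z lamZ … μ z u = 0`. -/
theorem tsum_lamZ_sources (μ : Fin (d + 1))
    (hAs : ∀ (x : Site (d + 1)) (κ : Fin (d + 1)), Summable (fun z : Site (d + 1) => A x (((bigRatio Lc (n + 1) : ℕ) : ℤ) • z) (Sum.inl κ) (Sum.inr μ)))
    (hface : ∀ (x : Site (d + 1)) (κ : Fin (d + 1)), quo (bigRatio Lc (n + 1)) x = quo (bigRatio Lc (n + 1)) (x + unitVec κ) →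
      (∑' z : Site (d + 1), A x (((bigRatio Lc (n + 1) : ℕ) : ℤ) • z) (Sum.inl κ) (Sum.inr μ)) = 0)
    (u : Site (d + 1)) :
    (∑' z : Site (d + 1), lamZ Lc lev rs hrs n A μ z u) = 0 :=
  (hasSum_lamZ_sources Lc lev rs hrs n A μ hAs hface u).tsum_eq

end Generic

/-! ## §2 At the record's chart `σ·AN·σ`: the hypotheses are PART 52's summability and the face read-out -/

section Record

variable {Lc : ℕ} [NeZero Lc] (R : Roots Lc) (lev : ℕ → ℕ) (rs : ℕ → (Fin (3 + 1) → ℕ))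
  (hrs : ∀ k i, 0 ≤ toSite (rs k) i ∧ toSite (rs k) i < (Lc : ℤ)) (n : ℕ) (σ : Fib 3 → ℝ)

/-- [folklore] the face read-out of the `σ`-conjugated chart vanishes on a bond whose endpoints share their `L`-block (PART 52 `tsum_scaleK_AN_inl_inr_sources_eq` + PART 53 `faceField_faceSupported`). -/
theorem tsum_scaleK_AN_sources_eq_zero_of_quo_eq (x : Site (3 + 1)) (κ μ : Fin (3 + 1))
    (h : quo (bigRatio Lc (n + 1)) x = quo (bigRatio Lc (n + 1)) (x + unitVec κ)) :
    (∑' z : Site (3 + 1), scaleK σ σ (AN R (n + 1)) x (((bigRatio Lc (n + 1) : ℕ) : ℤ) • z) (Sum.inl κ) (Sum.inr μ)) = 0 := by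
  rw [bigRatio_eq_pow] at h ⊢
  rw [tsum_scaleK_AN_inl_inr_sources_eq R (n + 1) σ σ x κ μ,
    faceField_faceSupported (Nat.one_le_iff_ne_zero.mpr (NeZero.ne (Lc ^ (n + 1 + 1))))
      (fun κ' _ => ((Lc ^ (n + 1 + 1) : ℕ) : ℝ) * (if κ' = μ then ((((Lc ^ (n + 1 + 1) : ℕ) : ℝ) ^ (3 + 1 + 1))⁻¹) else 0)) κ x h, mul_zero]

/-- [folklore] **`hasSum_lamZ_sources_record` — LEMMA U ON THE LATTICE FOR THE RECORD's CHART**: `HasSum (z ↦ lamZ Lc lev rs hrs n (scaleK σ σ (AN R (n+1))) μ z u) 0` for every lattice site `u`,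
every root list, unconditionally (PART 52's summability + the face read-out feed §1). -/
theorem hasSum_lamZ_sources_record (μ : Fin (3 + 1)) (u : Site (3 + 1)) :
    HasSum (fun z : Site (3 + 1) => lamZ Lc lev rs hrs n (scaleK σ σ (AN R (n + 1))) μ z u) 0 :=
  hasSum_lamZ_sources Lc lev rs hrs n (scaleK σ σ (AN R (n + 1))) μ
    (fun x κ => by rw [bigRatio_eq_pow]; exact summable_scaleK_AN_inl_inr_sources R (n + 1) σ σ x κ μ)
    (fun x κ h => tsum_scaleK_AN_sources_eq_zero_of_quo_eq R n σ x κ μ h) u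

/-- [folklore] **`tsum_lamZ_sources_record`**: `Σ'_z lamZ Lc lev rs hrs n (scaleK σ σ (AN R (n+1))) μ z u = 0` — K2L-LAM's «Λ_μ constant» ON THE LATTICE, the constant being `0`. -/
theorem tsum_lamZ_sources_record (μ : Fin (3 + 1)) (u : Site (3 + 1)) :
    (∑' z : Site (3 + 1), lamZ Lc lev rs hrs n (scaleK σ σ (AN R (n + 1))) μ z u) = 0 :=
  (hasSum_lamZ_sources_record R lev rs hrs n σ μ u).tsum_eq

end Record

end Summit.QuantumFields.BalabanUV.Beta.FP.TowerDoorGaugeLatticeSum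

end
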